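import Literature.IUT.HodgeTheaters.GenuineFKitOfBadLocalRealifiedOverPhi
import Literature.AlgebraicGeometry.Frobenioids.RealificationFrobeniusEquivalence
import HarnessLib

/-!
# The m4 dossier, negative half: the BARE one-object kind `SingleObj (CatAut 𝒞⊩_mod)` is NOT rigid — its automorphism group is
# nontrivial (abc-iut-L1-t3 ★ p499823: the Frobenius `powFunctor 2` of THE realified arithmetic Frobenioid is a self-equivalence `≇ 𝟭`)

S. Mochizuki, *Inter-universal Teichmüller theory I*, kurims manuscript (May 2020), Example 3.5 (i) p. 84, Remark 5.2.1 (ii) p. 143 («rigidity of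
the divisor monoids») ([IUTchI] Ex 3.5 (i) p.84) [claim: Mochizuki2012, status: disputed] (D-0012 claim key, series status DISPUTED — PROOF-ONLY
compositions by name; nothing of the series is asserted; no side is taken on [IUTchIII] Cor. 3.12).
S. Mochizuki, *The geometry of Frobenioids I*, Kyushu J. Math. **62** (2008), Prop. 2.1 (iii) p. 32, Prop. 5.3 p. 103 [cite: MochizukiFrdI2008, Prop. 2.1 (iii) p.32].

PURPOSE (abc-iut-L5-lead RULINGS #120 (1)(a) «bare-CatAut m4: refuted-at-bare-m4 when L1-t3's powFunctor-equivalence sequel is ✓» — that sequel is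
★ p499823 `arithRlf_exists_equivalence_not_iso_id`): IN KERNEL, the automorphism group of the model in the (m4) NON-VACUITY inhabitant
`RealifiedGlobalSide.ofNumberField L` (★ p497530, `Glob := SingleObj (CatAut (rlfArithCat L))`) is NONTRIVIAL — `exists_catAut_rlfArithCat_ne_one`,
`nontrivial_catAut_rlfArithCat`, `not_subsingleton_end_gModel_ofNumberField` — in contrast with the (m4) SLOT OF RECORD over `F_{Φ^rlf}`
(★ p500041 `subsingleton_end_gModel_ofNumberFieldOverPhi`).  Hence no [IUTchI] Cor. 5.6 (i) reading may be booked on the bare inhabitant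
(`RlfIsoFaithful` needs a trivial first factor, abc-iut-L1-t3 F1).  No definition, instance or notation; no `sorry`.
-/

noncomputable section

namespace Literature.IUT.HodgeTheaters

open CategoryTheory Literature.AlgebraicGeometry.Frobenioids

variable (L : Type) [Field L] [NumberField L]

/-- **`Aut(𝒞⊩_mod)` in the §0 sense is NONTRIVIAL**: the class of abc-iut-L1-t3's Frobenius self-equivalence (`powFunctor 2`, ★ p499823
`arithRlf_exists_equivalence_not_iso_id`) is `≠ 1` in `CatAut (rlfArithCat L)` (abc-iut-L5-t1/t4 `CatIsomorphism.mk_eq_mk_iff`).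
[cite: MochizukiFrdI2008, Prop. 2.1 (iii) p.32] -/
theorem exists_catAut_rlfArithCat_ne_one : ∃ c : CatAut (rlfArithCat L), c ≠ 1 := by
  obtain ⟨Ψ, -, -, hΨ⟩ := arithRlf_exists_equivalence_not_iso_id L
  refine ⟨CatIsomorphism.mk Ψ, fun h => hΨ ?_⟩
  rw [CatAut.one_def, CatIsomorphism.refl_eq_mk, CatIsomorphism.mk_eq_mk_iff] at h
  exact h

/-- `CatAut (rlfArithCat L)` is a nontrivial group. [cite: MochizukiFrdI2008, Prop. 2.1 (iii) p.32] -/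
theorem nontrivial_catAut_rlfArithCat : Nontrivial (CatAut (rlfArithCat L)) :=
  let ⟨c, hc⟩ := exists_catAut_rlfArithCat_ne_one L
  ⟨⟨c, 1, hc⟩⟩

namespace InitialThetaData

/-- **The BARE (m4) inhabitant is NOT rigid**: the endomorphisms of the model `𝒞⊩_mod` in `(RealifiedGlobalSide.ofNumberField L).Glob =
SingleObj (CatAut 𝒞⊩_mod)` do NOT form a subsingleton (contrast: `subsingleton_end_gModel_ofNumberFieldOverPhi` for the slot keyed over
`F_{Φ^rlf}`). So `RealifiedGlobalSide.ofNumberField` witnesses NON-VACUITY of (m4) only; the `⊩`-side readings use `…OverPhi`.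
([IUTchI] Rmk 5.2.1 (ii) p.143) [claim: Mochizuki2012, status: disputed] -/
theorem not_subsingleton_end_gModel_ofNumberField :
    letI := (RealifiedGlobalSide.ofNumberField L).cat
    ¬ Subsingleton ((RealifiedGlobalSide.ofNumberField L).gModel ⟶ (RealifiedGlobalSide.ofNumberField L).gModel) := by
  letI := (RealifiedGlobalSide.ofNumberField L).cat
  intro h
  obtain ⟨c, hc⟩ := exists_catAut_rlfArithCat_ne_one L
  exact hc (@Subsingleton.elim _ h c (𝟙 (RealifiedGlobalSide.ofNumberField L).gModel))

end InitialThetaData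

end Literature.IUT.HodgeTheaters

end
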